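import Summits.ValiantsHypothesis.ValiantsHypothesis.Theorems.LacunarySymmetroidMatrixDescartesCensusSqTwistRuns

/-!
# `MatrixDescartes` census — W4: the runs lemma past a common zero, and THEOREM R3c: edge `1..9` dead, in the kernel

HONEST FRAMING.  Object-search cell `pub-symmetroid`, item `DoorA26 = PosRootLawAt 2 6 19` (stmt-ValiantsHypothesis-19979,
OPEN, typed, never asserted).  W4 line (engine-1 g17–g21): degenerations of HYPOTHETICAL Descartes-sharp symmetric `2 × 2`
six-term pencils.  On chamber 1706 (pair-sum order of `(0,2,3,7,16,27)`; used here: `d₁ < d₂ < 2d₁`, `2d₂ < d₃`) a degeneration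
direction in a face containing the elbows `1` and `9` but neither `2` nor `3` has the hull edge `1..9`: nine Gram entries
`b₀₁, b₀₂, q₁₁, b₁₂, q₂₂, b₀₃, b₁₃, b₂₃, q₃₃` with the `{1,2,3}` block of rank one, i.e.
`F = σ·p² + 2b₁X^{d₁} + 2b₂X^{d₂} + 2b₃X^{d₃}`, `p = y₁X^{d₁} + y₂X^{d₂} + y₃X^{d₃}`, cell signs `σ < 0`, `b₁ < 0 < b₂, b₃`,
`y₁y₂ < 0 < y₁y₃`; sharpness would need `8 = #terms − 1` positive roots with multiplicity (seat note TROPFAN-W4-E1G17, ADDENDUM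
rev 3 (R3c): `≤ 6`).  This file proves `#Z₊^{mult}(F) ≤ 7 < 8`.  New ingredient: here `R = β₁X^{d₁} + β₂X^{d₂} + β₃X^{d₃}` changes
sign once, so `F = R − p²` and `p` MAY share a positive zero (at the zero of `R`); the runs lemma of `…CensusEdgeTwoNine` is re-proved
in a form that survives this (`countP_posRoots_le_of_sqTwist`: it bounds any divisor-like `F₁` whose positive zeros are zeros of `F`
off the zeros of `p`), and is applied to `F` itself when there is no common zero, else to `F /ₘ (X − τ)` for the unique common zero
`τ` (unique and simple because `#Z₊^{mult}(R) ≤ 1`).  With `Var(X·W) ≤ 3` (four sign blocks) and `p` a trinomial: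
`≤ 3 + 2 + 1 (+ 1 for τ) = 7`.  Mirror statement (edge `11..19` on chamber 954) by `d ↦ −d` bookkeeping, not typed here.  Nothing here
bounds `ζ_sym(2,6)`, decides `DoorA26`, or bears on the crux `MatrixDescartes` (stmt-ValiantsHypothesis-18050) / `VP ≠ VNP`: a dead
channel is a statement about hypothetical objects.

[folklore] Rolle with multiplicity for `F/p²` + Descartes' bound by sign blocks; no single source.
-/

-- `Summit.ValiantsHypothesis.ValiantsHypothesis.…` repeats a component by the D-0017 layout
-- (single-conjunct summit), which the `dupNamespace` linter flags; the name is mandated.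
set_option linter.dupNamespace false

namespace Summit.ValiantsHypothesis.ValiantsHypothesis.Theorems.LacunarySymmetroidMatrixDescartes.Census

open Polynomial Finset Set
open scoped BigOperators Polynomial
/-! ### THEOREM R3c: the hull edge `1..9` -/

/-- **THEOREM R3c (edge `1..9` dead, chamber-uniform).**  For all exponents `d₁ < d₂ < 2d₁`, `2d₂ < d₃` and all real letters with
the cell's signs `σ < 0`, `b₁ < 0 < b₂, b₃`, `y₁ > 0 > y₂`, `y₃ > 0`, the 9-term hull-edge form
`F = σ·(y₁X^{d₁} + y₂X^{d₂} + y₃X^{d₃})² + 2b₁X^{d₁} + 2b₂X^{d₂} + 2b₃X^{d₃}` has at most `7 < 8 = #terms − 1` positive roots COUNTED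
WITH MULTIPLICITY — so no hypothetical twenty on a chamber-1706 support degenerates in a direction whose hull has the edge `1..9`
(faces `∋ {1, 9}`, `∌ 2, 3` of `C₇`; mirror on 954).  (Sign-flipped triple: `countP_posRoots_zp_1_9_le'`.) [folklore] -/
theorem countP_posRoots_zp_1_9_le (d₁ d₂ d₃ : ℕ) (h₁ : d₁ < d₂) (h₂ : d₂ < 2 * d₁) (h₃ : 2 * d₂ < d₃)
    (σ b₁ b₂ b₃ y₁ y₂ y₃ : ℝ) (hσ : σ < 0) (hb₁ : b₁ < 0) (hb₂ : 0 < b₂) (hb₃ : 0 < b₃) (hy₁ : 0 < y₁) (hy₂ : y₂ < 0)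
    (hy₃ : 0 < y₃) :
    ((C σ * (C y₁ * X ^ d₁ + C y₂ * X ^ d₂ + C y₃ * X ^ d₃) ^ 2 + C (2 * b₁) * X ^ d₁ + C (2 * b₂) * X ^ d₂
      + C (2 * b₃) * X ^ d₃ : ℝ[X]).roots.countP (fun x => 0 < x)) ≤ 7 := by
  classical
  have hσ' : 0 < -σ := neg_pos.mpr hσ
  -- letters of the normal form `R − p²`
  obtain ⟨β₁, hβ₁⟩ : ∃ β : ℝ, β = 2 * b₁ / (-σ) := ⟨_, rfl⟩
  obtain ⟨β₂, hβ₂⟩ : ∃ β : ℝ, β = 2 * b₂ / (-σ) := ⟨_, rfl⟩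
  obtain ⟨β₃, hβ₃⟩ : ∃ β : ℝ, β = 2 * b₃ / (-σ) := ⟨_, rfl⟩
  have hβ₁n : β₁ < 0 := by rw [hβ₁]; exact div_neg_of_neg_of_pos (by linarith) hσ'
  have hβ₂p : 0 < β₂ := by rw [hβ₂]; exact div_pos (by linarith) hσ'
  have hβ₃p : 0 < β₃ := by rw [hβ₃]; exact div_pos (by linarith) hσ'
  obtain ⟨p, hpdef⟩ : ∃ q : ℝ[X], q = C y₁ * X ^ d₁ + C y₂ * X ^ d₂ + C y₃ * X ^ d₃ := ⟨_, rfl⟩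
  obtain ⟨R, hRdef⟩ : ∃ q : ℝ[X], q = C β₁ * X ^ d₁ + C β₂ * X ^ d₂ + C β₃ * X ^ d₃ := ⟨_, rfl⟩
  -- normalisation
  have hnorm : (C σ * (C y₁ * X ^ d₁ + C y₂ * X ^ d₂ + C y₃ * X ^ d₃) ^ 2 + C (2 * b₁) * X ^ d₁ + C (2 * b₂) * X ^ d₂
      + C (2 * b₃) * X ^ d₃ : ℝ[X]) = C (-σ) * (R - p ^ 2) := by
    have e1 : C (-σ) * C β₁ = (C (2 * b₁) : ℝ[X]) := by
      rw [← C_mul, hβ₁, mul_div_cancel₀ _ hσ'.ne']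
    have e2 : C (-σ) * C β₂ = (C (2 * b₂) : ℝ[X]) := by
      rw [← C_mul, hβ₂, mul_div_cancel₀ _ hσ'.ne']
    have e3 : C (-σ) * C β₃ = (C (2 * b₃) : ℝ[X]) := by
      rw [← C_mul, hβ₃, mul_div_cancel₀ _ hσ'.ne']
    have eσ : (C σ : ℝ[X]) = -C (-σ) := by rw [map_neg, neg_neg]
    rw [hRdef, ← hpdef, eσ]
    linear_combination (X ^ d₁) * e1.symm + (X ^ d₂) * e2.symm + (X ^ d₃) * e3.symm
  rw [hnorm, countP_posRoots_C_mul _ hσ'.ne']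
  -- arithmetic of the chamber
  have rd₁ : (0 : ℝ) < d₁ := by exact_mod_cast (show 0 < d₁ by omega)
  have rd₂ : (0 : ℝ) < d₂ := by exact_mod_cast (show 0 < d₂ by omega)
  have rd₃ : (0 : ℝ) < d₃ := by exact_mod_cast (show 0 < d₃ by omega)
  have r21 : (d₂ : ℝ) - 2 * d₁ < 0 := by
    have : (d₂ : ℝ) < 2 * d₁ := by exact_mod_cast h₂
    linarith
  have r12 : (d₁ : ℝ) - 2 * d₂ < 0 := by
    have : (d₁ : ℝ) < 2 * d₂ := by exact_mod_cast (show d₁ < 2 * d₂ by omega)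
    linarith
  have r31 : (0 : ℝ) < (d₃ : ℝ) - 2 * d₁ := by
    have : (2 * d₁ : ℝ) < d₃ := by exact_mod_cast (show 2 * d₁ < d₃ by omega)
    linarith
  have r13 : (d₁ : ℝ) - 2 * d₃ < 0 := by
    have : (d₁ : ℝ) < 2 * d₃ := by exact_mod_cast (show d₁ < 2 * d₃ by omega)
    linarith
  have r32 : (0 : ℝ) < (d₃ : ℝ) - 2 * d₂ := by
    have : (2 * d₂ : ℝ) < d₃ := by exact_mod_cast h₃
    linarith
  have r23 : (d₂ : ℝ) - 2 * d₃ < 0 := by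
    have : (d₂ : ℝ) < 2 * d₃ := by exact_mod_cast (show d₂ < 2 * d₃ by omega)
    linarith
  -- (1) `#Z₊^{mult}(R) ≤ 1` (sign blocks `− | +, +`)
  have hRcoeff : ∀ m, R.coeff m = (if m = d₁ then β₁ else 0) + (if m = d₂ then β₂ else 0) + (if m = d₃ then β₃ else 0) := by
    intro m
    rw [hRdef]
    simp only [coeff_add, coeff_C_mul, coeff_X_pow, mul_ite, mul_one, mul_zero]
  have hRdeg : R.natDegree < d₃ + 1 := by
    rw [Nat.lt_succ_iff, hRdef]
    refine (natDegree_add_le _ _).trans (max_le ((natDegree_add_le _ _).trans (max_le ?_ ?_)) ?_)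
    all_goals exact (natDegree_C_mul_X_pow_le _ _).trans (by omega)
  have hR0 : R ≠ 0 := by
    intro h0
    have := hRcoeff d₃
    rw [h0, coeff_zero, if_neg (by omega), if_neg (by omega), if_pos rfl] at this
    linarith
  have hZR : R.roots.countP (fun x => 0 < x) ≤ 1 := by
    have hv := signVariations_le_one_of_two_blocks R d₁ d₂ d₃ β₁ β₂ β₃ h₁ (by omega) hRcoeff hβ₁n.le hβ₂p.le hβ₃p.le hRdeg
    have := roots_countP_pos_le_signVariations R
    omega
  -- (2) the twist `W` and `Var(X·W) ≤ 3`
  obtain ⟨W, hWdef⟩ : ∃ q : ℝ[X], q = p * derivative R - 2 * R * derivative p := ⟨_, rfl⟩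
  have hXW := X_mul_sqTwist_edge_1_9 d₁ d₂ d₃ β₁ β₂ β₃ y₁ y₂ y₃
  rw [← hpdef, ← hRdef, ← hWdef] at hXW
  have hw₀ : 0 ≤ -(β₁ * y₁ * (d₁ : ℝ)) := by
    have := mul_pos (mul_pos (neg_pos.mpr hβ₁n) hy₁) rd₁
    linarith
  have hw₁ : β₂ * y₁ * ((d₂ : ℝ) - 2 * d₁) + β₁ * y₂ * ((d₁ : ℝ) - 2 * d₂) ≤ 0 := by
    have t1 : β₂ * y₁ * ((d₂ : ℝ) - 2 * d₁) < 0 := mul_neg_of_pos_of_neg (mul_pos hβ₂p hy₁) r21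
    have t2 : β₁ * y₂ * ((d₁ : ℝ) - 2 * d₂) < 0 := mul_neg_of_pos_of_neg (mul_pos_of_neg_of_neg hβ₁n hy₂) r12
    linarith
  have hw₂ : 0 ≤ -(β₂ * y₂ * (d₂ : ℝ)) := by
    have := mul_pos (mul_pos hβ₂p (neg_pos.mpr hy₂)) rd₂
    linarith
  have hw₃ : 0 ≤ β₃ * y₁ * ((d₃ : ℝ) - 2 * d₁) + β₁ * y₃ * ((d₁ : ℝ) - 2 * d₃) := by
    have t1 : 0 < β₃ * y₁ * ((d₃ : ℝ) - 2 * d₁) := mul_pos (mul_pos hβ₃p hy₁) r31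
    have t2 : 0 < β₁ * y₃ * ((d₁ : ℝ) - 2 * d₃) := mul_pos_of_neg_of_neg (mul_neg_of_neg_of_pos hβ₁n hy₃) r13
    linarith
  have hw₄ : β₃ * y₂ * ((d₃ : ℝ) - 2 * d₂) + β₂ * y₃ * ((d₂ : ℝ) - 2 * d₃) ≤ 0 := by
    have t1 : β₃ * y₂ * ((d₃ : ℝ) - 2 * d₂) < 0 :=
      mul_neg_of_neg_of_pos (mul_neg_of_pos_of_neg hβ₃p hy₂) r32
    have t2 : β₂ * y₃ * ((d₂ : ℝ) - 2 * d₃) < 0 := mul_neg_of_pos_of_neg (mul_pos hβ₂p hy₃) r23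
    linarith
  have hw₅' : 0 < β₃ * y₃ * (d₃ : ℝ) := mul_pos (mul_pos hβ₃p hy₃) rd₃
  have hw₅ : -(β₃ * y₃ * (d₃ : ℝ)) ≤ 0 := by linarith
  have hcoeff : ∀ m, (X * W).coeff m = (if m = 2 * d₁ then -(β₁ * y₁ * (d₁ : ℝ)) else 0)
      + (if m = d₁ + d₂ then β₂ * y₁ * ((d₂ : ℝ) - 2 * d₁) + β₁ * y₂ * ((d₁ : ℝ) - 2 * d₂) else 0)
      + (if m = 2 * d₂ then -(β₂ * y₂ * (d₂ : ℝ)) else 0)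
      + (if m = d₁ + d₃ then β₃ * y₁ * ((d₃ : ℝ) - 2 * d₁) + β₁ * y₃ * ((d₁ : ℝ) - 2 * d₃) else 0)
      + (if m = d₂ + d₃ then β₃ * y₂ * ((d₃ : ℝ) - 2 * d₂) + β₂ * y₃ * ((d₂ : ℝ) - 2 * d₃) else 0)
      + (if m = 2 * d₃ then -(β₃ * y₃ * (d₃ : ℝ)) else 0) := by
    intro m
    rw [hXW]
    simp only [coeff_add, coeff_C_mul, coeff_X_pow, mul_ite, mul_one, mul_zero]
  have hXW0 : X * W ≠ 0 := by
    intro h0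
    have := hcoeff (2 * d₃)
    rw [h0, coeff_zero, if_neg (by omega), if_neg (by omega), if_neg (by omega), if_neg (by omega), if_neg (by omega),
      if_pos rfl] at this
    linarith
  have hW0 : W ≠ 0 := fun h => hXW0 (by rw [h, mul_zero])
  have hdeg : (X * W).natDegree < 2 * d₃ + 1 := by
    rw [Nat.lt_succ_iff, hXW]
    refine (natDegree_add_le _ _).trans (max_le ((natDegree_add_le _ _).trans (max_le ((natDegree_add_le _ _).trans
      (max_le ((natDegree_add_le _ _).trans (max_le ((natDegree_add_le _ _).trans (max_le ?_ ?_)) ?_)) ?_)) ?_)) ?_)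
    all_goals exact (natDegree_C_mul_X_pow_le _ _).trans (by omega)
  have hvar : (X * W).signVariations ≤ 3 :=
    signVariations_le_three_of_four_blocks (X * W) (2 * d₁) (d₁ + d₂) (2 * d₂) (d₁ + d₃) (d₂ + d₃) (2 * d₃)
      _ _ _ _ _ _ (by omega) (by omega) (by omega) (by omega) (by omega) hcoeff hw₀ hw₁ hw₂ hw₃ hw₄ hw₅ hdeg
  have hZW : W.roots.countP (fun x => 0 < x) ≤ 3 := by
    have h1 : W.roots.countP (fun x => 0 < x) = (X * W).roots.countP (fun x => 0 < x) := by
      rw [← countP_posRoots_X_pow_mul W 1, pow_one]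
    rw [h1]
    have := roots_countP_pos_le_signVariations (X * W)
    omega
  -- (3) `p` is a trinomial
  have hp0 : p ≠ 0 := by
    intro h
    apply hW0
    rw [hWdef, h]; simp
  have hZp : p.roots.countP (fun x => 0 < x) ≤ 2 := by
    have := countP_posRoots_lt_card_support hp0
    have h3 : p.support.card ≤ 3 := by
      rw [hpdef]
      exact (Finset.card_le_card (support_trinomial_subset d₁ d₂ d₃ y₁ y₂ y₃)).trans Finset.card_le_three
    omega
  -- (4) the form `F = R − p²`, its twist identity, and the common zeros of `F` and `p`
  obtain ⟨F, hFdef⟩ : ∃ q : ℝ[X], q = R - p ^ 2 := ⟨_, rfl⟩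
  rw [← hFdef]
  have hWF : W = p * derivative F - 2 * derivative p * F := by rw [hWdef, hFdef, sqTwist_identity]
  have hFeval : ∀ u, F.eval u = R.eval u - p.eval u ^ 2 := by
    intro u; rw [hFdef, eval_sub, eval_pow]
  -- at a common positive zero of `F` and `p`: `R = 0`, and the zero of `F` is simple
  have hcommon : ∀ x : ℝ, 0 < x → F.IsRoot x → p.eval x = 0 → R.IsRoot x ∧ F.rootMultiplicity x = 1 := by
    intro x hx hFx hpx
    have hRx : R.eval x = 0 := by
      have := hFeval x; rw [hFx.eq_zero, hpx] at this; linarith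
    refine ⟨hRx, ?_⟩
    -- `R` has a simple zero at `x` (else `#Z₊^{mult}(R) ≥ 2`), and `F′(x) = R′(x)`
    have hRx1 : R.rootMultiplicity x ≤ 1 := by
      have h1 : R.rootMultiplicity x ≤ R.roots.countP (fun x => 0 < x) := by
        rw [countP_posRoots_eq_sum_rootMultiplicity]
        have hxr : x ∈ R.roots.toFinset.filter (fun x => 0 < x) := by
          simp only [Finset.mem_filter, Multiset.mem_toFinset, mem_roots hR0]
          exact ⟨hRx, hx⟩
        exact Finset.single_le_sum (f := fun y => R.rootMultiplicity y) (fun _ _ => Nat.zero_le _) hxr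
      omega
    have hR'x : (derivative R).eval x ≠ 0 := by
      intro h0
      have h2 : 1 < R.rootMultiplicity x := (one_lt_rootMultiplicity_iff_isRoot hR0).mpr ⟨hRx, h0⟩
      omega
    have hF0 : F ≠ 0 := by
      intro h0
      apply hW0
      rw [hWF, h0]; simp
    have hF'x : (derivative F).eval x ≠ 0 := by
      have : derivative F = derivative R - 2 * p * derivative p := by
        rw [hFdef, derivative_sub, sq, derivative_mul]; ring
      rw [this, eval_sub, eval_mul, eval_mul, eval_ofNat, hpx]
      simpa using hR'x
    have hge : 1 ≤ F.rootMultiplicity x := (rootMultiplicity_pos hF0).mpr hFx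
    have hle : F.rootMultiplicity x ≤ 1 := by
      by_contra hc
      have h2 : 1 < F.rootMultiplicity x := by omega
      rw [one_lt_rootMultiplicity_iff_isRoot hF0] at h2
      exact hF'x h2.2
    omega
  -- (5) case analysis on the existence of a common positive zero
  by_cases hex : ∃ τ : ℝ, 0 < τ ∧ F.IsRoot τ ∧ p.eval τ = 0
  · obtain ⟨τ, hτ0, hFτ, hpτ⟩ := hex
    obtain ⟨hRτ, hmτ⟩ := hcommon τ hτ0 hFτ hpτ
    have hF0 : F ≠ 0 := by
      intro h0; rw [h0, rootMultiplicity_zero] at hmτ; exact zero_ne_one hmτ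
    -- split off the simple zero `τ`
    set F₁ := F /ₘ (X - C τ) with hF₁def
    have hfac : F = (X - C τ) * F₁ := by rw [hF₁def, mul_divByMonic_eq_iff_isRoot.mpr hFτ]
    have hF₁0 : F₁ ≠ 0 := by
      intro h0; rw [h0, mul_zero] at hfac; exact hF0 hfac
    have hXτ0 : (X - C τ : ℝ[X]) ≠ 0 := X_sub_C_ne_zero τ
    have hprod0 : (X - C τ) * F₁ ≠ 0 := mul_ne_zero hXτ0 hF₁0
    have hmulF : ∀ x, F.rootMultiplicity x = (X - C τ : ℝ[X]).rootMultiplicity x + F₁.rootMultiplicity x := by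
      intro x; rw [hfac, rootMultiplicity_mul hprod0]
    have hF₁τ : ¬ F₁.IsRoot τ := by
      intro h
      have h1 := hmulF τ
      rw [rootMultiplicity_X_sub_C_self, hmτ] at h1
      have h2 : 1 ≤ F₁.rootMultiplicity τ := (rootMultiplicity_pos hF₁0).mpr h
      omega
    -- the unique common zero is `τ`
    have huniq : ∀ x : ℝ, 0 < x → F.IsRoot x → p.eval x = 0 → x = τ := by
      intro x hx hFx hpx
      obtain ⟨hRx, _⟩ := hcommon x hx hFx hpx
      by_contra hne
      -- two distinct positive zeros of `R` contradict `#Z₊^{mult}(R) ≤ 1`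
      have h2 : 2 ≤ R.roots.countP (fun x => 0 < x) := by
        rw [countP_posRoots_eq_sum_rootMultiplicity]
        have hsub2 : ({x, τ} : Finset ℝ) ⊆ R.roots.toFinset.filter (fun x => 0 < x) := by
          intro y hy
          simp only [Finset.mem_insert, Finset.mem_singleton] at hy
          simp only [Finset.mem_filter, Multiset.mem_toFinset, mem_roots hR0]
          rcases hy with rfl | rfl
          · exact ⟨hRx, hx⟩
          · exact ⟨hRτ, hτ0⟩
        have hle := Finset.sum_le_sum_of_subset_of_nonneg hsub2 (fun y _ _ => Nat.zero_le (R.rootMultiplicity y))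
        rw [Finset.sum_pair hne] at hle
        have hmx : 1 ≤ R.rootMultiplicity x := (rootMultiplicity_pos hR0).mpr hRx
        have hmτ' : 1 ≤ R.rootMultiplicity τ := (rootMultiplicity_pos hR0).mpr hRτ
        omega
      omega
    have hsub : ∀ x : ℝ, 0 < x → F₁.IsRoot x → F.IsRoot x ∧ p.eval x ≠ 0 := by
      intro x hx hF₁x
      have hFx : F.IsRoot x := by
        rw [IsRoot.def, hfac, eval_mul, hF₁x.eq_zero, mul_zero]
      refine ⟨hFx, fun hpx => ?_⟩
      have := huniq x hx hFx hpx
      subst this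
      exact hF₁τ hF₁x
    have hmul : ∀ x : ℝ, 0 < x → F₁.IsRoot x → F₁.rootMultiplicity x ≤ F.rootMultiplicity x := by
      intro x _ _; rw [hmulF x]; omega
    have key := countP_posRoots_le_of_sqTwist F F₁ p W hWF hW0 hF₁0 hsub hmul
    have hsplit : F.roots.countP (fun x => 0 < x) = 1 + F₁.roots.countP (fun x => 0 < x) := by
      have hcx : (X - C τ : ℝ[X]).roots.countP (fun x => 0 < x) = 1 := by
        rw [roots_X_sub_C, ← Multiset.cons_zero, Multiset.countP_cons_of_pos _ hτ0, Multiset.countP_zero]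
      rw [hfac, roots_mul hprod0, Multiset.countP_add, hcx]
    omega
  · push Not at hex
    have hF0 : F ≠ 0 := by
      intro h0
      apply hW0
      rw [hWF, h0]; simp
    have hsub : ∀ x : ℝ, 0 < x → F.IsRoot x → F.IsRoot x ∧ p.eval x ≠ 0 :=
      fun x hx hFx => ⟨hFx, hex x hx hFx⟩
    have key := countP_posRoots_le_of_sqTwist F F p W hWF hW0 hF0 hsub (fun _ _ _ => le_rfl)
    omega

/-- **THEOREM R3c, sign-flipped triple** (`y₁ < 0 < y₂`, `y₃ < 0`): same bound, since `F` only sees `p²`. [folklore] -/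
theorem countP_posRoots_zp_1_9_le' (d₁ d₂ d₃ : ℕ) (h₁ : d₁ < d₂) (h₂ : d₂ < 2 * d₁) (h₃ : 2 * d₂ < d₃)
    (σ b₁ b₂ b₃ y₁ y₂ y₃ : ℝ) (hσ : σ < 0) (hb₁ : b₁ < 0) (hb₂ : 0 < b₂) (hb₃ : 0 < b₃) (hy₁ : y₁ < 0) (hy₂ : 0 < y₂)
    (hy₃ : y₃ < 0) :
    ((C σ * (C y₁ * X ^ d₁ + C y₂ * X ^ d₂ + C y₃ * X ^ d₃) ^ 2 + C (2 * b₁) * X ^ d₁ + C (2 * b₂) * X ^ d₂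
      + C (2 * b₃) * X ^ d₃ : ℝ[X]).roots.countP (fun x => 0 < x)) ≤ 7 := by
  have hsq : ((C y₁ * X ^ d₁ + C y₂ * X ^ d₂ + C y₃ * X ^ d₃) ^ 2 : ℝ[X])
      = (C (-y₁) * X ^ d₁ + C (-y₂) * X ^ d₂ + C (-y₃) * X ^ d₃) ^ 2 := by
    simp only [map_neg]; ring
  rw [hsq]
  exact countP_posRoots_zp_1_9_le d₁ d₂ d₃ h₁ h₂ h₃ σ b₁ b₂ b₃ (-y₁) (-y₂) (-y₃) hσ hb₁ hb₂ hb₃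
    (neg_pos.mpr hy₁) (neg_neg_of_pos hy₂) (neg_pos.mpr hy₃)

end Summit.ValiantsHypothesis.ValiantsHypothesis.Theorems.LacunarySymmetroidMatrixDescartes.Census
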